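import Mathlib
import Summits.Ventures.PercRepro.TriangleCapDenseEnvelope

/-!
# PercRepro — THE EQUALITY LOCUS OF THE `K₄⁻`-FREE CHERRY ENVELOPE FOR `k ≥ 7`: the complete bipartite
spanning graphs, hence only the diagonal cells `m = a(k−a)` (p3, gen 34; part 29)

TriangleCapDenseEnvelope gives `2·Σ_v C(d(v), 2) + 2m ≤ m·k` for every `K₄⁻`-free graph on `k ≥ 6` vertices with
`m` edges, attained by `K_{a, k−a}`.  This module determines the equality locus for `k ≥ 7`:

* `card_triangles3_eq_zero_of_cliqueFree` — a triangle-free graph has no ordered triangles;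
* `sum_deficit_eq_zero_of_dense_eq` — at equality (`k ≥ 7`) every ordered adjacent pair has deficit `0`
  (`deficit_eq_zero_of_dense_eq`): every vertex is adjacent to `u` or to `v` for every edge `u v`
  (`adj_or_adj_of_dense_eq`);
* **`complete_bipartite_of_dense_eq`** — at equality (`k ≥ 7`) the graph is complete bipartite spanning:
  there is a set `A` of vertices with `x ~ y ↔ Xor (x ∈ A) (y ∈ A)` (`A = N(v)` for any vertex `v` of an edge;
  `A = ∅` when there is no edge);
* `deg_eq_of_complete_bipartite`, `card_edges_eq_of_complete_bipartite` — on such a graph `d(x) = k − |A|` for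
  `x ∈ A`, `d(x) = |A|` otherwise, and `m = |A| (k − |A|)`;
* **`dense_eq_iff`** — for `k ≥ 7` and `K₄⁻`-free `D`: `2·cherries + 2m = m·k ↔ D` is complete bipartite spanning;
* **`card_edges_eq_mul_of_dense_eq`** — equality forces `m = a (k − a)` for some `a ≤ k`: OFF the diagonal cells the
  envelope is strict for every `k ≥ 7`.

At `k = 6` the prism `C₃ × K₂` (two triangles, `9` edges, `Σ d² = 54 = 9·6`) also attains the envelope, so `k ≥ 7` is
sharp for the structure.  Axioms: standard.
-/

namespace PercRepro

namespace TriangleCap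

namespace C047

open Finset

variable {V : Type*} [Fintype V] [DecidableEq V]

/-- A triangle-free graph has no ordered triangles. -/
theorem card_triangles3_eq_zero_of_cliqueFree (D : SimpleGraph V) [DecidableRel D.Adj]
    (hfree : D.CliqueFree 3) : (triangles3 D).card = 0 := by
  rw [card_eq_zero, eq_empty_iff_forall_notMem]
  intro t ht
  rw [mem_triangles3] at ht
  exact hfree {t.1.1, t.1.2, t.2} (SimpleGraph.is3Clique_triple_iff.mpr ⟨ht.1, ht.2.1, ht.2.2⟩)

/-- At equality (`k ≥ 7`) the deficits vanish in total. -/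
theorem sum_deficit_eq_zero_of_dense_eq (D : SimpleGraph V) [DecidableRel D.Adj] (hK : K4mFree D)
    (hk : 7 ≤ Fintype.card V)
    (heq : 2 * cherries D + 2 * D.edgeFinset.card = D.edgeFinset.card * Fintype.card V) :
    ∑ p ∈ adjPairsAll D, deficit D p = 0 := by
  have h1 := two_mul_sum_deg_sq_add_sum_deficit D
  have h2 := card_triangles3_eq_zero_of_cliqueFree D (cliqueFree_of_dense_eq D hK hk heq)
  rw [← two_mul_cherries_add, sum_deg_eq, h2] at h1
  have h3 : 2 * (D.edgeFinset.card * Fintype.card V) = 2 * D.edgeFinset.card * Fintype.card V := by ring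
  rw [heq, h3] at h1
  omega

/-- At equality (`k ≥ 7`) every ordered adjacent pair has deficit `0`. -/
theorem deficit_eq_zero_of_dense_eq (D : SimpleGraph V) [DecidableRel D.Adj] (hK : K4mFree D)
    (hk : 7 ≤ Fintype.card V)
    (heq : 2 * cherries D + 2 * D.edgeFinset.card = D.edgeFinset.card * Fintype.card V)
    {u v : V} (huv : D.Adj u v) : deficit D (u, v) = 0 := by
  have h := sum_deficit_eq_zero_of_dense_eq D hK hk heq
  rw [sum_eq_zero_iff] at h
  exact h (u, v) ((mem_adjPairsAll D (u, v)).mpr huv)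

/-- At equality (`k ≥ 7`) every vertex is adjacent to `u` or to `v`, for every edge `u v`. -/
theorem adj_or_adj_of_dense_eq (D : SimpleGraph V) [DecidableRel D.Adj] (hK : K4mFree D)
    (hk : 7 ≤ Fintype.card V)
    (heq : 2 * cherries D + 2 * D.edgeFinset.card = D.edgeFinset.card * Fintype.card V)
    {u v : V} (huv : D.Adj u v) (x : V) : D.Adj u x ∨ D.Adj v x := by
  have h := deficit_eq_zero_of_dense_eq D hK hk heq huv
  unfold deficit at h
  rw [card_eq_zero, filter_eq_empty_iff] at h
  have hx := h (mem_univ x)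
  dsimp only at hx
  tauto

/-- At equality (`k ≥ 7`) an edge has no common neighbour. -/
theorem not_adj_adj_of_dense_eq (D : SimpleGraph V) [DecidableRel D.Adj] (hK : K4mFree D)
    (hk : 7 ≤ Fintype.card V)
    (heq : 2 * cherries D + 2 * D.edgeFinset.card = D.edgeFinset.card * Fintype.card V)
    {u v x : V} (huv : D.Adj u v) (hux : D.Adj u x) (hvx : D.Adj v x) : False :=
  cliqueFree_of_dense_eq D hK hk heq {u, v, x} (SimpleGraph.is3Clique_triple_iff.mpr ⟨huv, hux, hvx⟩)

/-- **THE EQUALITY LOCUS FOR `k ≥ 7`:** a `K₄⁻`-free graph on `k ≥ 7` vertices attaining `2·cherries + 2m = m·k`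
is complete bipartite spanning: some vertex set `A` has `x ~ y ↔ Xor (x ∈ A) (y ∈ A)`. -/
theorem complete_bipartite_of_dense_eq (D : SimpleGraph V) [DecidableRel D.Adj] (hK : K4mFree D)
    (hk : 7 ≤ Fintype.card V)
    (heq : 2 * cherries D + 2 * D.edgeFinset.card = D.edgeFinset.card * Fintype.card V) :
    ∃ A : Finset V, ∀ x y, D.Adj x y ↔ Xor (x ∈ A) (y ∈ A) := by
  by_cases hE : ∃ u v, D.Adj u v
  · obtain ⟨u, v, huv⟩ := hE
    refine ⟨univ.filter (fun x => D.Adj v x), fun x y => ?_⟩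
    simp only [mem_filter, mem_univ, true_and]
    constructor
    · intro hxy
      unfold Xor
      by_cases hvx : D.Adj v x
      · by_cases hvy : D.Adj v y
        · exact (not_adj_adj_of_dense_eq D hK hk heq hxy hvx.symm hvy.symm).elim
        · exact Or.inl ⟨hvx, hvy⟩
      · by_cases hvy : D.Adj v y
        · exact Or.inr ⟨hvy, hvx⟩
        · have hux : D.Adj u x := (adj_or_adj_of_dense_eq D hK hk heq huv x).resolve_right hvx
          have huy : D.Adj u y := (adj_or_adj_of_dense_eq D hK hk heq huv y).resolve_right hvy
          exact (not_adj_adj_of_dense_eq D hK hk heq hxy hux.symm huy.symm).elim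
    · intro hxor
      unfold Xor at hxor
      rcases hxor with ⟨hvx, hvy⟩ | ⟨hvy, hvx⟩
      · exact (adj_or_adj_of_dense_eq D hK hk heq hvx y).resolve_left hvy
      · exact ((adj_or_adj_of_dense_eq D hK hk heq hvy x).resolve_left hvx).symm
  · have hE' : ∀ x y, ¬ D.Adj x y := fun x y h => hE ⟨x, y, h⟩
    refine ⟨∅, fun x y => ?_⟩
    simp only [notMem_empty]
    unfold Xor
    simp only [false_and, or_self, iff_false]
    exact hE' x y

/-- On a complete bipartite spanning graph with parts `A`, `Aᶜ`: `d(x) = k − |A|` for `x ∈ A`, `d(x) = |A|` for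
`x ∉ A`. -/
theorem deg_eq_of_complete_bipartite (D : SimpleGraph V) [DecidableRel D.Adj] (A : Finset V)
    (hA : ∀ x y, D.Adj x y ↔ Xor (x ∈ A) (y ∈ A)) (x : V) :
    deg D x = if x ∈ A then Fintype.card V - A.card else A.card := by
  unfold deg
  by_cases hx : x ∈ A
  · rw [if_pos hx]
    have e : univ.filter (fun w => D.Adj x w) = Aᶜ := by
      ext w
      simp only [mem_filter, mem_univ, true_and, mem_compl, hA]
      unfold Xor
      tauto
    rw [e, card_compl]
  · rw [if_neg hx]
    have e : univ.filter (fun w => D.Adj x w) = A := by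
      ext w
      simp only [mem_filter, mem_univ, true_and, hA]
      unfold Xor
      tauto
    rw [e]

/-- On a complete bipartite spanning graph with parts `A`, `Aᶜ` there are `|A| (k − |A|)` edges. -/
theorem card_edges_eq_of_complete_bipartite (D : SimpleGraph V) [DecidableRel D.Adj] (A : Finset V)
    (hA : ∀ x y, D.Adj x y ↔ Xor (x ∈ A) (y ∈ A)) :
    D.edgeFinset.card = A.card * (Fintype.card V - A.card) := by
  have h := sum_deg_eq D
  have h2 : ∑ v, deg D v = ∑ v, (if v ∈ A then Fintype.card V - A.card else A.card) :=
    sum_congr rfl (fun v _ => deg_eq_of_complete_bipartite D A hA v)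
  rw [h2, sum_ite, sum_const, sum_const, smul_eq_mul, smul_eq_mul] at h
  have e1 : (univ.filter (fun v => v ∈ A)) = A := by
    ext v
    simp only [mem_filter, mem_univ, true_and]
  have e2 : (univ.filter (fun v => ¬ v ∈ A)) = Aᶜ := by
    ext v
    simp only [mem_filter, mem_univ, true_and, mem_compl]
  rw [e1, e2, card_compl] at h
  have h3 : A.card ≤ Fintype.card V := card_le_univ A
  have h4 : A.card * (Fintype.card V - A.card) + (Fintype.card V - A.card) * A.card =
      2 * (A.card * (Fintype.card V - A.card)) := by ring
  omega

/-- **THE EQUALITY LOCUS, AS AN EQUIVALENCE (`k ≥ 7`):** a `K₄⁻`-free graph on `k ≥ 7` vertices attains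
`2·cherries + 2m = m·k` iff it is complete bipartite spanning. -/
theorem dense_eq_iff (D : SimpleGraph V) [DecidableRel D.Adj] (hK : K4mFree D)
    (hk : 7 ≤ Fintype.card V) :
    2 * cherries D + 2 * D.edgeFinset.card = D.edgeFinset.card * Fintype.card V ↔
      ∃ A : Finset V, ∀ x y, D.Adj x y ↔ Xor (x ∈ A) (y ∈ A) := by
  constructor
  · exact complete_bipartite_of_dense_eq D hK hk
  · rintro ⟨A, hA⟩
    have hm := card_edges_eq_of_complete_bipartite D A hA
    have hdeg := deg_eq_of_complete_bipartite D A hA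
    have hA' : A.card ≤ Fintype.card V := card_le_univ A
    obtain ⟨b, hb⟩ := Nat.exists_eq_add_of_le hA'
    -- `2·C(d, 2) + d = d²` vertex by vertex, then the two part sums
    have hsq : ∑ v, deg D v * deg D v =
        A.card * ((Fintype.card V - A.card) * (Fintype.card V - A.card)) +
          (Fintype.card V - A.card) * (A.card * A.card) := by
      have h2 : ∑ v, deg D v * deg D v =
          ∑ v, (if v ∈ A then (Fintype.card V - A.card) * (Fintype.card V - A.card)
            else A.card * A.card) := by
        apply sum_congr rfl
        intro v _
        rw [hdeg v]
        split_ifs <;> rfl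
      rw [h2, sum_ite, sum_const, sum_const, smul_eq_mul, smul_eq_mul]
      have e1 : (univ.filter (fun v => v ∈ A)) = A := by
        ext v
        simp only [mem_filter, mem_univ, true_and]
      have e2 : (univ.filter (fun v => ¬ v ∈ A)) = Aᶜ := by
        ext v
        simp only [mem_filter, mem_univ, true_and, mem_compl]
      rw [e1, e2, card_compl]
    have h := two_mul_cherries_add D
    rw [sum_deg_eq, hsq, hm] at h
    rw [hb, Nat.add_sub_cancel_left] at h
    rw [hm, hb, Nat.add_sub_cancel_left]
    linarith [h]

/-- **OFF THE DIAGONAL THE ENVELOPE IS STRICT (`k ≥ 7`):** equality forces `m = a (k − a)` for some `a ≤ k`. -/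
theorem card_edges_eq_mul_of_dense_eq (D : SimpleGraph V) [DecidableRel D.Adj] (hK : K4mFree D)
    (hk : 7 ≤ Fintype.card V)
    (heq : 2 * cherries D + 2 * D.edgeFinset.card = D.edgeFinset.card * Fintype.card V) :
    ∃ a, a ≤ Fintype.card V ∧ D.edgeFinset.card = a * (Fintype.card V - a) := by
  obtain ⟨A, hA⟩ := complete_bipartite_of_dense_eq D hK hk heq
  exact ⟨A.card, card_le_univ A, card_edges_eq_of_complete_bipartite D A hA⟩

end C047

end TriangleCap

end PercRepro
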